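import Mathlib.Geometry.Manifold.Instances.Sphere
import Literature.Topology.FourManifolds.Trisections
import Literature.Topology.FourManifolds.ConnectedSum
import Literature.Topology.FourManifolds.ConnectedSumSpheres
import Literature.Topology.FourManifolds.ComplexProjectiveSpace
import Literature.Topology.FourManifolds.SmoothOrientation
import HarnessLib

/-!
# Trisections with a sector of `kᵢ ≥ g − 1` one-handles are standard (Meier–Schirmer–Zupan 2016, Thm. 1.2)

Topic `Literature/Topology/FourManifolds`, after `Trisections.lean` (the Gay–Kirby predicate
`Literature.Topology.FourManifolds.IsGKTrisection X g k S`: sectors with corners along the central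
surface, unbalanced types `(g; k 0, k 1, k 2)`), `ConnectedSum.lean` (the relational connected
sum `Literature.Topology.FourManifolds.IsConnectedSum`) and `ComplexProjectiveSpace.lean`
(`Literature.Topology.FourManifolds.ComplexProjectivePlane`, a closed smooth 4-manifold charted
on `ℝ⁴`).  The tree so far held only the HOMOTOPY-SPHERE corollaries of the theorem
(`Literature.Barriers.SmoothPoincare4.msz_homotopySphere_gk`,
`Literature.Topology.FourManifolds.msz_standard_homotopySphere`, conclusion "`≅ S⁴`"); this file
vendors the classification itself, whose outputs are in general NOT simply connected
(`#^{k′}(S¹ × S³)`), as needed for loop partners of homotopy 4-spheres (route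
`SmoothPoincare4/WeakReductionDescent`, crux K2).

## What is printed

J. Meier, T. Schirmer, A. Zupan, *Classification of trisections and the Generalized Property R
Conjecture*, Proc. AMS 144 (2016) 4983–4997; arXiv:1507.06561 (v1, the only arXiv version; the
held text).  Definition 1.1: for a closed, connected, orientable, smooth four-manifold `X`, a
`(g; k₁, k₂, k₃)`-trisection is `X = X₁ ∪ X₂ ∪ X₃` with `Xᵢ ≅ ♮^{kᵢ}(S¹ × B³)`, `Xᵢ ∩ Xⱼ` a genus-`g`
handlebody for `i ≠ j`, and `Σ = X₁ ∩ X₂ ∩ X₃` a closed orientable surface of genus `g`.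
**Theorem 1.2** (`thm:class`; restated verbatim before its proof in §5):

> "Suppose that `X` admits a `(g; k₁, k₂, k₃)`–trisection `𝒯` with `k₁ ≥ g − 1`, and let
> `k′ = max{k₂, k₃}`. Then, `X` is diffeomorphic either to `#^{k′}(S¹ × S³)` or to the connected
> sum of `#^{k′} S¹ × S³` with one of `ℂP²` or `ℂP²‾`, and `𝒯` is the connected sum of genus one
> trisections."

(Convention `#⁰(S¹ × S³) = S⁴`: Meier–Zupan, *Genus-two trisections are standard*, §1, "`X` is
diffeomorphic to `#ᵍ(S¹ × S³)` (where `#⁰(S¹ × S³) = S⁴`)"; MSZ §2: "throughout, we define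
`#⁰(S¹ × S²) = S³`".)  Proof (§5): the case `k₁ = g` "is trivial, since it implies `X` has a handle
decomposition without 2–handles and must be the connected sum of `k₂ = k₃` copies of `S¹ × S³`";
for `k₁ = g − 1` a Heegaard–Kirby diagram (§4) presents `X` by `k₂` one-handles, ONE two-handle
attached along a knot `L ⊂ #^{k₂}(S¹ × S²)` and `k₃` three-handles; "If necessary, permute `X₂`
and `X₃` so that `k₃ ≥ k₂`. By Theorem 5.1" (surgeries between connected sums of `S¹ × S²`:
Gabai 1987, Scharlemann 1990, Gordon–Luecke) "the knot `L` is an unknot in `#^{k₂}(S¹ × S²)` and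
`k₃ ∈ {k₂, k₂ + 1}`", whence the splitting, by induction on `g` through reducibility.  Remark 5.2:
"if `𝒯` is a `(g; g, k₂, k₃)`–trisection, then `k₂ = k₃`. Similarly, if `𝒯` is a
`(g; g − 1, k₂, k₃)`–trisection, then we have that `k₃ ∈ {k₂ − 1, k₂, k₂ + 1}`. In addition, if a
manifold `X` with a `(g; g − 1, k₂, k₃)`–trisection `𝒯` has a `ℂP²` or `ℂP²‾` summand, then […]
`𝒯` must have parameters `(g; g − 1, k₃, k₃)`."

## `max` is a misprint for `min` (checked against the paper itself and a secondary source)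

With `k′ = max{k₂, k₃}` the printed sentence is contradicted inside the paper: the
`2`-stabilisation of the genus-`0` trisection of `S⁴` (Def. 3.7: an `i`-stabilisation turns
`(g; k₁, k₂, k₃)` into `(g + 1; …, kᵢ + 1, …)`; §1: "three more unbalanced trisection of genus
one, which correspond to the three stabilizations of the genus zero trisection of `S⁴`") is a
`(1; 0, 1, 0)`-trisection of `S⁴` with `k₁ = 0 = g − 1` and `max{k₂, k₃} = 1`, but
`S⁴ ≇ S¹ × S³`, `S⁴ ≇ (S¹ × S³) # ℂP²` (Euler characteristics `2`, `0`, `1`).  The proof gives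
`k′ = min{k₂, k₃}`: after the permutation making `k₃ ≥ k₂` the manifold is `#^{k₂}(S¹ × S³)`
(`0`-framed unknot, `k₃ = k₂ + 1`, the two-handle cancels a three-handle) or
`#^{k₂}(S¹ × S³) # (±ℂP²)` (`±1`-framed unknot, `k₃ = k₂`), and `k₂ = min{k₂, k₃}`; in the case
`k₁ = g` one has `k₂ = k₃ = min = max`.  This agrees with `χ(X) = 2 + g − k₁ − k₂ − k₃`
(Gay–Kirby, Remark 2) on every type, and with Remark 5.2 above.  The zbMATH review of the
paper (M. Tange, Zbl 1381.57018) states the main result with the corrected parameter: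
"Let `k′` be `min{k₂, k₃}`. If `k₁ ≥ g − 1`, then `X` is diffeomorphic either to
`#^{k′}(S¹ × S³)` or to the connected sum of `#^{k′}(S¹ × S³)` with one of `ℂP²` or `ℂP²‾`, and
`𝒯` is the connected sum of genus one trisections."  The fact below is vendored with
`k′ = min{k₂, k₃}`; nothing else is changed.  (Aranda–Zupan 2025, Prop. 2.6, quote the result
parameter-free: "[MSZ16] Suppose that `𝒯` is a `(g; k₁, k₂, k₃)`-trisection, where `kᵢ ≥ g − 1`
for some `i`. Then `𝒯` is reducible and can be expressed as the connected sum of genus-one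
trisections.")

## How it is rendered here (relative to the tree's notions, D-0014)

* `IsCircleProdSum n P` — **`P` is a connected sum of `n` copies of `S¹ × S³`** (real
  definition, an inductive family in `n`): `IsCircleProdSum 0 P` iff `P` is diffeomorphic to the
  round `𝕊⁴` (`#⁰(S¹ × S³) = S⁴`), and `IsCircleProdSum (n + 1) P` iff `P` is a connected sum
  `M # (S¹ × S³)` — `IsConnectedSum (𝓡 4) (𝓡 4) ((𝓡 1).prod (𝓡 3)) M (Circle × 𝕊³) P`, with
  `S¹ × S³` rendered as Mathlib's `Circle × 𝕊³` on the product model, verbatim the shape of the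
  conclusion of `Literature.Topology.FourManifolds.Trisection.isConnectedSum_circleProd_of_reducing_nonseparating`
  (`ReducibleTrisectionSplitting.lean`) — of a closed connected smooth 4-manifold `M` (Hausdorff,
  second countable, compact, connected, `C^∞` on `ℝ⁴`, same universe as `P`) with
  `IsCircleProdSum n M`.  So the `n` summands are split off one at a time
  (`(⋯((S⁴ # S¹×S³) # S¹×S³)⋯) # S¹×S³`); no associativity/commutativity of `#` is presupposed
  (Kervaire–Milnor 1963, Lemma 2.1), and the relational `IsConnectedSum` allows arbitrary gluing
  discs.  API (proved): `isCircleProdSum_zero_iff`, `isCircleProdSum_succ_iff`,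
  `IsCircleProdSum.sphere_self`, `IsCircleProdSum.of_diffeomorph` (invariance under
  diffeomorphism of `P`, from `IsConnectedSum.of_diffeomorph`), `IsCircleProdSum.nonempty`.
* `msz_trisection_classification_gk` — the NAMED FACT (Thm. 1.2 with `k′ = min`), for a closed
  connected oriented smooth 4-manifold `X` (`[CompactSpace X] [ConnectedSpace X]`, an explicit
  `SmoothOrientation (𝓡 4) X`, as in the sibling facts) with `IsGKTrisection X g k S`: the printed
  sector `X₁` is the sector `S 0`, the hypothesis `k₁ ≥ g − 1` is written `g ≤ k 0 + 1` (no
  `ℕ`-subtraction), `k′ = min (k 1) (k 2)`, and the conclusion is the disjunction of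
  `IsCircleProdSum k′ X` ("`X ≅ #^{k′}(S¹ × S³)`": the class is invariant under diffeomorphism) and
  "`X` is a connected sum `M # ℂP²` of a closed connected smooth `M` with `IsCircleProdSum k′ M`":
  `IsConnectedSum (𝓡 4) (𝓡 4) (𝓡 4) M ComplexProjectivePlane X`.  The two printed alternatives
  `# ℂP²` and `# ℂP²‾` are both covered by, and together exhaust, this single relational clause:
  the tree's `IsConnectedSum` is unoriented and glues along ARBITRARY smooth discs
  `i₁ : ℝ⁴ ↪ M`, `i₂ : ℝ⁴ ↪ ℂP²`, and the oriented sums `M # ℂP²`, `M # ℂP²‾` are exactly the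
  gluings with `i₂` orientation-reversing, resp. orientation-preserving, for the complex
  orientation (Kervaire–Milnor 1963, §2; for the summands here, which admit orientation-reversing
  self-diffeomorphisms, the two are moreover diffeomorphic as unoriented manifolds).
* Proved consequences: the relabelled forms `msz_trisection_classification_gk.of_perm`
  (any sector may play `X₁`, by `IsGKTrisection.comp_perm`) and `.of_exists`
  (hypothesis `∃ i, g ≤ k i + 1`, the shape used by `msz_homotopySphere_gk`, with `k′` the minimum
  over the two other sectors).

NOT rendered: the last clause "`𝒯` is the connected sum of genus one trisections" (the tree has
no connected sum OF TRISECTIONS; only the underlying manifold statement is vendored), the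
uniqueness/position of the splitting spheres, and Remark 5.2's constraints on the parameters
(consequences of `χ(X) = 2 + g − Σ kᵢ`, `TrisectionEulerProofs.lean`).  Numbering: arXiv v1 and
the journal agree (Def. 1.1, Thm. 1.2, Cor. 1.3; the zbMATH review cites "Corollary 1.3");
`SmallTrisections.lean` calls the theorem "Thm. 1.1", `LowGenusTrisectionsStandard.lean`
"Thm. 1.2 (arXiv numbering)" — the same theorem.

Nothing in this file is proved except the API of `IsCircleProdSum` and the relabellings; users
take `(h : msz_trisection_classification_gk)`.

## References

* J. Meier, T. Schirmer, A. Zupan, *Classification of trisections and the Generalized Property R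
  Conjecture*, Proc. Amer. Math. Soc. 144 (2016) 4983–4997 (arXiv:1507.06561): Def. 1.1,
  Thm. 1.2 (`thm:class`) and its proof in §5 (via Thm. 5.1), Remark 5.2, Def. 3.7, Remark 3.12.
  [MeierSchirmerZupan2016]
* M. Tange, review of the above, zbMATH Open, Zbl 1381.57018 (main result stated with
  `k′ = min{k₂, k₃}`). [Tange2018ZblMSZ]
* J. Meier, A. Zupan, *Genus-two trisections are standard*, Geom. Topol. 21 (2017) 1583–1630
  (arXiv:1410.8133), §1 (`#⁰(S¹ × S³) = S⁴`; `(g, g)`-trisections give `#ᵍ(S¹ × S³)`).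
  [MeierZupan2017]
* R. Aranda, A. Zupan, *Manifolds with weakly reducible genus-three trisections are standard*,
  arXiv:2503.04607 (2025), Prop. 2.6 (the parameter-free restatement). [ArandaZupan2025]
* D. Gay, R. Kirby, *Trisecting 4-manifolds*, Geom. Topol. 20 (2016) 3097–3132, Def. 1,
  Remark 2. [GayKirby2016]
* M. Kervaire, J. Milnor, *Groups of homotopy spheres I*, Ann. of Math. 77 (1963), §2,
  Lemma 2.1 (connected sum; orientations). [KervaireMilnor1963]
-/

noncomputable section

open scoped Manifold ContDiff Topology
open Set

namespace Literature.Topology.FourManifolds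

universe u

/-- Local notation: `𝔼 n` is the model Euclidean space `EuclideanSpace ℝ (Fin n)`. -/
local notation "𝔼 " n:arg => EuclideanSpace ℝ (Fin n)

/-- Local notation: `𝕊 n` is the unit sphere in `EuclideanSpace ℝ (Fin (n + 1))`. -/
local notation "𝕊 " n:arg => (Metric.sphere (0 : EuclideanSpace ℝ (Fin (n + 1))) 1)

/-! ### Connected sums of copies of `S¹ × S³` -/

/-- **`P` is a connected sum of `n` copies of `S¹ × S³`** (`#ⁿ(S¹ × S³)`, with the convention
`#⁰(S¹ × S³) = S⁴` of Meier–Zupan §1 / Meier–Schirmer–Zupan §2), for a charted space `P` on `ℝ⁴`: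
the inductive family with (`sphere`) `IsCircleProdSum 0 P` for every `P` diffeomorphic to the
round `𝕊⁴`, and (`succ`) `IsCircleProdSum (n + 1) P` whenever `P` is a connected sum
`M # (S¹ × S³)` — the tree's relational `IsConnectedSum (𝓡 4) (𝓡 4) ((𝓡 1).prod (𝓡 3)) M (Circle × 𝕊³) P`
(Kervaire–Milnor's gluing of `M ∖ {pt}` and `(S¹ × S³) ∖ {pt}` along punctured discs, along
arbitrary smooth discs; `S¹ × S³` is Mathlib's `Circle × 𝕊³` on the product model, as in
`Trisection.isConnectedSum_circleProd_of_reducing_nonseparating`) — of a closed connected smooth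
4-manifold `M` (Hausdorff, second countable, compact, connected, `C^∞`) with `IsCircleProdSum n M`.
The summands are thus split off one at a time; no associativity or commutativity of `#` is
presupposed, no hypothesis is put on `P` (consumers add `[IsManifold (𝓡 4) ∞ P]`), and the class
is invariant under diffeomorphism of `P` (`IsCircleProdSum.of_diffeomorph`).
[cite: MeierZupan2017, §1 ("diffeomorphic to #^g(S¹ × S³) (where #^0(S¹ × S³) = S⁴)")] -/
inductive IsCircleProdSum :
    ℕ → ∀ (P : Type u) [TopologicalSpace P] [ChartedSpace (𝔼 4) P], Prop
  /-- `#⁰(S¹ × S³) = S⁴`: a manifold diffeomorphic to the round `𝕊⁴` is a connected sum of zero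
  copies of `S¹ × S³`. -/
  | sphere {P : Type u} [TopologicalSpace P] [ChartedSpace (𝔼 4) P]
      (e : P ≃ₘ⟮𝓡 4, 𝓡 4⟯ 𝕊 4) : IsCircleProdSum 0 P
  /-- `#ⁿ⁺¹(S¹ × S³) = #ⁿ(S¹ × S³) # (S¹ × S³)`: a connected sum (relational,
  `Literature.Topology.FourManifolds.IsConnectedSum`) of a closed connected smooth `M` which is a
  connected sum of `n` copies of `S¹ × S³` with `Circle × 𝕊³` is a connected sum of `n + 1`
  copies. -/
  | succ {n : ℕ} {M P : Type u} [TopologicalSpace M] [T2Space M] [SecondCountableTopology M]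
      [ChartedSpace (𝔼 4) M] [IsManifold (𝓡 4) ∞ M] [CompactSpace M] [ConnectedSpace M]
      [TopologicalSpace P] [ChartedSpace (𝔼 4) P]
      (hM : IsCircleProdSum n M)
      (h : IsConnectedSum (𝓡 4) (𝓡 4) ((𝓡 1).prod (𝓡 3)) M (Circle × (𝕊 3)) P) :
      IsCircleProdSum (n + 1) P

/-- The round sphere `𝕊⁴` itself is `#⁰(S¹ × S³)`, via the identity diffeomorphism.
[cite: MeierZupan2017, §1 ("#^0(S¹ × S³) = S⁴")] -/
theorem IsCircleProdSum.sphere_self : IsCircleProdSum 0 (𝕊 4) :=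
  .sphere (Diffeomorph.refl (𝓡 4) (𝕊 4) ∞)

/-- Unfolding lemma at `0`: `P` is a connected sum of zero copies of `S¹ × S³` iff `P` is
diffeomorphic to `𝕊⁴`. [cite: MeierZupan2017, §1 ("#^0(S¹ × S³) = S⁴")] -/
theorem isCircleProdSum_zero_iff {P : Type u} [TopologicalSpace P] [ChartedSpace (𝔼 4) P] :
    IsCircleProdSum 0 P ↔ Nonempty (P ≃ₘ⟮𝓡 4, 𝓡 4⟯ 𝕊 4) := by
  constructor
  · intro h
    cases h with
    | sphere e => exact ⟨e⟩
  · rintro ⟨e⟩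
    exact .sphere e

/-- Unfolding lemma at `n + 1`: `P` is a connected sum of `n + 1` copies of `S¹ × S³` iff `P` is
a connected sum `M # (S¹ × S³)` of a closed connected smooth `M` which is a connected sum of `n`
copies (the constructor `succ`). [folklore] -/
theorem isCircleProdSum_succ_iff {n : ℕ} {P : Type u} [TopologicalSpace P]
    [ChartedSpace (𝔼 4) P] :
    IsCircleProdSum (n + 1) P ↔
      ∃ (M : Type u) (_ : TopologicalSpace M) (_ : T2Space M) (_ : SecondCountableTopology M)
        (_ : ChartedSpace (𝔼 4) M) (_ : IsManifold (𝓡 4) ∞ M) (_ : CompactSpace M)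
        (_ : ConnectedSpace M),
        IsCircleProdSum n M ∧ IsConnectedSum (𝓡 4) (𝓡 4) ((𝓡 1).prod (𝓡 3)) M (Circle × (𝕊 3)) P := by
  constructor
  · intro h
    cases h with
    | @succ _ M _ _ _ _ _ _ _ _ _ _ hM h =>
      exact ⟨M, ‹_›, ‹_›, ‹_›, ‹_›, ‹_›, ‹_›, ‹_›, hM, h⟩
  · rintro ⟨M, _, _, _, _, _, _, _, hM, h⟩
    exact .succ hM h

/-- **Being a connected sum of `n` copies of `S¹ × S³` is invariant under diffeomorphism** onto a
`C^∞` manifold: compose the diffeomorphism with the witness at `n = 0`, and transport the open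
gluing along it (`IsConnectedSum.of_diffeomorph`) at `n + 1`.  So "`P` is diffeomorphic to
`#ⁿ(S¹ × S³)`" and "`IsCircleProdSum n P`" agree. [cite: KervaireMilnor1963, §2] -/
theorem IsCircleProdSum.of_diffeomorph {n : ℕ} {P : Type u} [TopologicalSpace P]
    [ChartedSpace (𝔼 4) P] (h : IsCircleProdSum n P) {P' : Type u} [TopologicalSpace P']
    [ChartedSpace (𝔼 4) P'] [IsManifold (𝓡 4) ∞ P'] (e : P ≃ₘ⟮𝓡 4, 𝓡 4⟯ P') :
    IsCircleProdSum n P' := by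
  cases h with
  | sphere e₀ => exact .sphere (e.symm.trans e₀)
  | succ hM h => exact .succ hM (h.of_diffeomorph e)

/-- A manifold diffeomorphic (in either direction) to the round `𝕊⁴` is `#⁰(S¹ × S³)`.
[cite: MeierZupan2017, §1 ("#^0(S¹ × S³) = S⁴")] -/
theorem IsCircleProdSum.of_diffeomorph_sphere {P : Type u} [TopologicalSpace P]
    [ChartedSpace (𝔼 4) P] (e : (𝕊 4) ≃ₘ⟮𝓡 4, 𝓡 4⟯ P) : IsCircleProdSum 0 P :=
  .sphere e.symm

/-- A connected sum of copies of `S¹ × S³` is nonempty (a copy of `𝕊⁴` is nonempty; a connected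
sum along `4`-discs is nonempty, `IsConnectedSum.nonempty`). [folklore] -/
theorem IsCircleProdSum.nonempty {n : ℕ} {P : Type u} [TopologicalSpace P]
    [ChartedSpace (𝔼 4) P] (h : IsCircleProdSum n P) : Nonempty P := by
  cases h with
  | sphere e =>
    have : Nonempty (𝕊 4) := ⟨⟨EuclideanSpace.single 0 1, by simp⟩⟩
    exact this.map e.symm
  | succ hM h => exact h.nonempty

/-! ### The classification (named fact) -/

/-- **Meier–Schirmer–Zupan 2016, Thm. 1.2 (named fact): trisections with `k₁ ≥ g − 1` are
connected sums of genus-one trisections — the underlying manifolds.**  Let `X` be a closed,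
connected, oriented smooth 4-manifold (Hausdorff, second countable, compact, connected, `C^∞` on
`ℝ⁴`, with a `SmoothOrientation`) with a `(g; k 0, k 1, k 2)`-trisection `S` in the sense of
Gay–Kirby with corners (`IsGKTrisection X g k S`; MSZ Def. 1.1) such that `k 0 + 1 ≥ g` (the
printed `k₁ ≥ g − 1`, the sector `S 0` playing `X₁`).  Printed (Thm. 1.2): "let
`k′ = max{k₂, k₃}`. Then, `X` is diffeomorphic either to `#^{k′}(S¹ × S³)` or to the connected
sum of `#^{k′} S¹ × S³` with one of `ℂP²` or `ℂP²‾`, and `𝒯` is the connected sum of genus one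
trisections", where `max` is a misprint for `min` (the paper's own `(1; 0, 1, 0)`-trisection of
`S⁴`, its proof — "permute `X₂` and `X₃` so that `k₃ ≥ k₂` […] `L` is an unknot in
`#^{k₂}(S¹ × S²)` and `k₃ ∈ {k₂, k₂ + 1}`" — and Remark 5.2 all give `min`; so does the zbMATH
review Zbl 1381.57018: "Let `k′` be `min{k₂, k₃}`"; see the module docstring).  Rendered, with
`k′ = min (k 1) (k 2)`: EITHER `X` is a connected sum of `k′` copies of `S¹ × S³`
(`IsCircleProdSum k′ X`, `#⁰ = S⁴`), OR `X` is a connected sum `M # ℂP²`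
(`IsConnectedSum (𝓡 4) (𝓡 4) (𝓡 4) M ComplexProjectivePlane X`, the unoriented relational sum
along arbitrary discs, which covers both `# ℂP²` and `# ℂP²‾`) of a closed connected smooth `M`
with `IsCircleProdSum k′ M`.  The clause "`𝒯` is the connected sum of genus one trisections" is
NOT rendered.  The printed proof rests on Thm. 5.1 there (Dehn surgeries between `#ᵏ(S¹ × S²)`'s:
Gabai, Scharlemann, Gordon–Luecke), Heegaard–Kirby diagrams (§4, Laudenbach–Poénaru) and
Waldhausen's theorem; none of it is in the tree.  Relabelled forms: `.of_perm`, `.of_exists`.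
Users take `(h : msz_trisection_classification_gk)`.
[cite: MeierSchirmerZupan2016, Thm. 1.2 (arXiv:1507.06561 thm:class; proof in §5 via Thm. 5.1; Remark 5.2)]
[cite: Tange2018ZblMSZ, main result (k′ = min{k₂, k₃})] -/
def msz_trisection_classification_gk : Prop :=
  ∀ (X : Type u) [TopologicalSpace X] [T2Space X] [SecondCountableTopology X]
    [ChartedSpace (𝔼 4) X] [IsManifold (𝓡 4) ∞ X] [CompactSpace X] [ConnectedSpace X]
    (_ : SmoothOrientation (𝓡 4) X) (g : ℕ) (k : Fin 3 → ℕ) (S : Fin 3 → Set X),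
    IsGKTrisection X g k S → g ≤ k 0 + 1 →
      IsCircleProdSum (min (k 1) (k 2)) X ∨
      ∃ (M : Type u) (_ : TopologicalSpace M) (_ : T2Space M) (_ : SecondCountableTopology M)
        (_ : ChartedSpace (𝔼 4) M) (_ : IsManifold (𝓡 4) ∞ M) (_ : CompactSpace M)
        (_ : ConnectedSpace M),
        IsCircleProdSum (min (k 1) (k 2)) M ∧
          IsConnectedSum (𝓡 4) (𝓡 4) (𝓡 4) M ComplexProjectivePlane X

namespace msz_trisection_classification_gk

variable {X : Type u} [TopologicalSpace X] [T2Space X] [SecondCountableTopology X]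
  [ChartedSpace (𝔼 4) X] [IsManifold (𝓡 4) ∞ X] [CompactSpace X] [ConnectedSpace X]

/-- **Relabelled form: any sector may play `X₁`.**  GIVEN the fact, for a permutation `σ` of the
three sectors with `g ≤ k (σ 0) + 1`, the manifold is `#^{k′}(S¹ × S³)` or `#^{k′}(S¹ × S³) # (±ℂP²)`
with `k′ = min (k (σ 1)) (k (σ 2))` — apply the fact to the relabelled trisection
`IsGKTrisection X g (k ∘ σ) (S ∘ σ)` (`IsGKTrisection.comp_perm`; MSZ: "permute `X₂` and `X₃`",
Remark 4.3 on the symmetry of trisections).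
[cite: MeierSchirmerZupan2016, Thm. 1.2 and Remark 4.3] -/
theorem of_perm (h : msz_trisection_classification_gk.{u}) (o : SmoothOrientation (𝓡 4) X)
    {g : ℕ} {k : Fin 3 → ℕ} {S : Fin 3 → Set X} (hS : IsGKTrisection X g k S)
    (σ : Equiv.Perm (Fin 3)) (hσ : g ≤ k (σ 0) + 1) :
    IsCircleProdSum (min (k (σ 1)) (k (σ 2))) X ∨
      ∃ (M : Type u) (_ : TopologicalSpace M) (_ : T2Space M) (_ : SecondCountableTopology M)
        (_ : ChartedSpace (𝔼 4) M) (_ : IsManifold (𝓡 4) ∞ M) (_ : CompactSpace M)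
        (_ : ConnectedSpace M),
        IsCircleProdSum (min (k (σ 1)) (k (σ 2))) M ∧
          IsConnectedSum (𝓡 4) (𝓡 4) (𝓡 4) M ComplexProjectivePlane X :=
  h X o g (k ∘ σ) (S ∘ σ) (hS.comp_perm σ) hσ

/-- **Existential form** (the hypothesis shape of `msz_homotopySphere_gk`): GIVEN the fact, if
SOME sector has `kᵢ + 1 ≥ g`, then for some `k′` — namely the minimum of the two other `kⱼ` — the
manifold is `#^{k′}(S¹ × S³)` or `#^{k′}(S¹ × S³) # (±ℂP²)` (relabel by the transposition
`(0 i)`). [cite: MeierSchirmerZupan2016, Thm. 1.2 and Remark 4.3] -/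
theorem of_exists (h : msz_trisection_classification_gk.{u}) (o : SmoothOrientation (𝓡 4) X)
    {g : ℕ} {k : Fin 3 → ℕ} {S : Fin 3 → Set X} (hS : IsGKTrisection X g k S)
    (hk : ∃ i, g ≤ k i + 1) :
    ∃ k' : ℕ, IsCircleProdSum k' X ∨
      ∃ (M : Type u) (_ : TopologicalSpace M) (_ : T2Space M) (_ : SecondCountableTopology M)
        (_ : ChartedSpace (𝔼 4) M) (_ : IsManifold (𝓡 4) ∞ M) (_ : CompactSpace M)
        (_ : ConnectedSpace M),
        IsCircleProdSum k' M ∧ IsConnectedSum (𝓡 4) (𝓡 4) (𝓡 4) M ComplexProjectivePlane X := by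
  obtain ⟨i, hi⟩ := hk
  refine ⟨_, h.of_perm o hS (Equiv.swap 0 i) ?_⟩
  rwa [Equiv.swap_apply_left]

/-- **Relabelled form with named sectors**: GIVEN the fact, if `{i, j, l} = {0, 1, 2}` and
`g ≤ k i + 1`, then the manifold is `#^{k′}(S¹ × S³)` or `#^{k′}(S¹ × S³) # (±ℂP²)` with
`k′ = min (k j) (k l)`. [cite: MeierSchirmerZupan2016, Thm. 1.2 and Remark 4.3] -/
theorem of_le (h : msz_trisection_classification_gk.{u}) (o : SmoothOrientation (𝓡 4) X)
    {g : ℕ} {k : Fin 3 → ℕ} {S : Fin 3 → Set X} (hS : IsGKTrisection X g k S) {i j l : Fin 3}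
    (hij : i ≠ j) (hil : i ≠ l) (hjl : j ≠ l) (hi : g ≤ k i + 1) :
    IsCircleProdSum (min (k j) (k l)) X ∨
      ∃ (M : Type u) (_ : TopologicalSpace M) (_ : T2Space M) (_ : SecondCountableTopology M)
        (_ : ChartedSpace (𝔼 4) M) (_ : IsManifold (𝓡 4) ∞ M) (_ : CompactSpace M)
        (_ : ConnectedSpace M),
        IsCircleProdSum (min (k j) (k l)) M ∧
          IsConnectedSum (𝓡 4) (𝓡 4) (𝓡 4) M ComplexProjectivePlane X := by
  have key : ∀ a b c : Fin 3, a ≠ b → a ≠ c → b ≠ c →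
      ∃ σ : Equiv.Perm (Fin 3), σ 0 = a ∧ σ 1 = b ∧ σ 2 = c := by
    decide
  obtain ⟨σ, h0, h1, h2⟩ := key i j l hij hil hjl
  have := h.of_perm o hS σ (by rw [h0]; exact hi)
  rwa [h1, h2] at this

end msz_trisection_classification_gk

end Literature.Topology.FourManifolds

end
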